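import Summits.QuantumFields.YangMills.Theorems.BalabanUVNodesN16KingModelTwoRunHolderDeriv

/-!
# Route «BalabanUVNodes» (K3⁶ `SpineGivenEndpointR13SepCoPR`), DAG node N16 = NE3 — THE KING-MODEL RUNG OF NE3, (3.71) LINE 4 FOR THE
# BLOCK-AVERAGED TWO-RUN DISCREPANCY, PART 2: the derivative-Hölder quotient `|x − y|^{−α}(∂^η_μD_b(x) − ∂^η_μD_b(y))` of the KERNEL
# discrepancy `D_b = ℋ_K(·, b) − Q_nℋ_{K+n}(·, b)` on Bałaban's volumes WITH KING's DECAY around the blocks of the two pairs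

Cell `pub-ymgap`, seat `pub-ymgap-dag-n16-c` (R134 acceleration seat, strategy s1; HUMAN RULING D-0062; chair R424 venue), generation 10.
`--kind proof --supports stmt-QuantumFields-20509 --as helper` (K3⁶, dag-lead WORDS-142).  `bears_on: R4∕N16 · row «R2^ϱ, the unprinted core»`.

WHY THIS FILE.  PART 1 (`BalabanUVNodesN16KingModelTwoRunHolderDeriv`) proved, on EVERY volume, King's (3.71) line 4 for the block-averaged
two-run kernel discrepancy with the sup-norm rate `(L^{−γ})^K` and NO decay in the source point `b` — enough for the `ℓ¹`-datum form, not
for the sup-datum form (summing over `b` costs the volume).  THIS file re-runs PART 1's mechanism (block-mean ∕ difference commutation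
`N16KingModelBlockShift.coarseDeriv_blockMean_eq`, fibre translation `N16KingModelTranslate.blockMean_translate` ∕ `holdist_translate` at
EQUAL unit distance, the dichotomy `over_add_nsmul_cases` «fine point over `x` or over `x + e_μ`», the mixed patch) with DECAYING inputs
— King's «combining our bounds with Theorem 3.3» (p. 674): n18-b's `MinimizerHolderDecay.king_prop38_holder_deriv_torus_blocks` ((3.71)
line 4 with the decay `exp[−(δ∕2)·min(|B(x) − b|, |B(y) − b|)]`) at the two pairs `(x, x + v)`, `(x + e_μ, x + e_μ + v)`, and
`MinimizerHolderDecay.holder_dkernel_decay_blocks` at exponent `s = α + γ∕2` for the two neighbour patches `|∂ℋ_K(z + e_μ) − ∂ℋ_K(z)|`,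
`z ∈ {x, x + v}` (distance `|z + e_μ − z| = (L^K)⁻¹`, `N16KingModelDeriv.holdist_add_unitVec`): they cost `c₁(L^K)^{−s}`, the Hölder weight
`|x − (x + v)|^{−α} ≤ (L^K)^α` (`N16KingModelHolderDeriv.rpow_neg_holdist_le`, `v ≠ 0`) leaves `(L^K)^{−γ∕2}` — the rate of the main term.
The result is a per-kernel bound with EIGHT decay profiles (four blocks `B(x), B(x+v), B(x+e_μ), B(x+e_μ+v)` at rate `δ∕2`, four at rate
`δ₁`), which PART 3 (`BalabanUVNodesN16KingModelTwoRunHolderDerivSup`) sums over the datum into the level- and volume-free sup-norm form.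

WHAT THIS FILE PROVES (kernel; ONE theorem, 0 `def`, 0 sorry):
★ `twoRunHolderDeriv_kernel_blockMean_decay_le` — for `d ≥ 1`, odd `L ≥ 2`, `a, m² > 0`, `0 < α`, `0 < γ`, `α + γ < 1` there are
`δ, c, δ₁, c₁ > 0` (functions of `d, L, a, m², α, γ` only) such that for EVERY volume `P = (d, L, m, K)` of the `B1∕B4` tower, `K ≥ 1`,
every `n ≥ 1`, every source `b`, coarse points `x, x + v`, direction `μ`, with `ρ = holdist L^K M x (x + v)`, `N = L^K`:
`|ρ^{−α}·(∂^η_μD_b(x) − ∂^η_μD_b(x + v))| ≤ R_K,n·Σ_{z ∈ {x, x+v, x+e_μ, x+e_μ+v}} e^{−(δ∕2)|B(z) − b|} + c₁·N^{−γ∕2}·Σ_{z ∈ {x+e_μ, x, x+v+e_μ, x+v}} e^{−δ₁|B(z) − b|}`,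
`R_K,n = √(C₅⁗(K, n)·N^{−γ}·2c)` King's line-4 rate factor (`≤ √(2c·C₅⁗_unif)·(L^{−γ∕2})^K` by n18-a's `sqrt_rate_le_unif`, used in PART 3).

HONEST FRAMING.  A MODEL LAYER ([King1986] printed AND proved; kernel re-proof BY NAME from the tree's King files).  NOTHING of
[Balaban1985RegularSpaces] ∕ [Balaban1985Variational] is proved or discharged; N16 ∕ NE3 is NOT discharged (in-edges N05 — [B8] Thm 4 ∕ Prop 3
at the pinned all-torus members — and N07 — [B11] Thm 1 (8)+(10) — remain hypotheses of the chain of record); COUNT UNMOVED; count-neutral;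
one finite torus at a time — NOT ℝ⁴, NOT infinite volume, NOT OS, NOT a mass gap, NOT Clay.

Sources: C. King, *The U(1) Higgs model. I. The continuum limit*, Commun. Math. Phys. **102** (1986) 649–677 [King1986], Prop. 3.8
(3.71) p. 664 (line 4), (3.62) p. 663, Thm 3.3 (3.7)–(3.8) p. 658, Prop. 3.7 (3.65) p. 663, §4 pp. 672–674; T. Bałaban, *Regularity and
decay of lattice Green's functions*, Commun. Math. Phys. **89** (1983) 571–597 [Balaban1983RegularityDecay], Thm (1.10) p. 573.
-/

set_option autoImplicit false

noncomputable section

open Real Finset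
open scoped BigOperators

namespace Summit.QuantumFields.YangMills.BalabanUVNodes.N16KingModelHolderDerivDecay

open Literature.MathematicalPhysics.QuantumFieldTheory.Balaban1983to89 (Params)
open Literature.MathematicalPhysics.QuantumFieldTheory.Balaban1983to89.B5Prop11Plancherel (Tor fine unitVec)
open Literature.MathematicalPhysics.QuantumFieldTheory.King1986
  (aK lemma43Const fprop38RateConst fprop38PosConst aliasConst)
open Literature.MathematicalPhysics.QuantumFieldTheory.King1986.Torus
  (minimiser blockOf tdistT tdistT_nonneg holdist king_prop38_holder_deriv_torus_blocks holder_dkernel_decay_blocks)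
open Summit.QuantumFields.YangMills.BalabanUVNodes.N16KingModel (mem_overFib overFib_nonempty abs_blockMean_sub_le)
open Summit.QuantumFields.YangMills.BalabanUVNodes.N16KingModelBlockShift (over_add_nsmul_cases coarseDeriv_blockMean_eq)
open Summit.QuantumFields.YangMills.BalabanUVNodes.N16KingModelTranslate
  (over_add_translate blockMean_translate blockMean_mul_sub holdist_translate)
open Summit.QuantumFields.YangMills.BalabanUVNodes.N16KingModelDeriv
  (abs_le_of_holder_bound holdist_add_unitVec abs_rangeMean_sub_le exp_neg_mul_min_le)
open Summit.QuantumFields.YangMills.BalabanUVNodes.N16KingModelHolderDeriv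
  (holdist_pair_shift rpow_neg_holdist_le weight_rangeMean_sub)

variable {d : ℕ}

/-! ## ★ On Bałaban's volumes: the derivative-Hölder quotient of the two-run KERNEL discrepancy with King's decay -/

/-- ★ **(3.71) LINE 4 WITH DECAY FOR THE BLOCK-AVERAGED TWO-RUN KERNEL DISCREPANCY** (statement in the module docstring): King's line 4
«combined with Theorem 3.3» at the translated fine pairs read by the derivative of the block mean, averaged over `j < Lⁿ` and over the fibre;
eight decay profiles (the blocks of `x, x + v, x + e_μ, x + e_μ + v` at rate `δ∕2` from `king_prop38_holder_deriv_torus_blocks`, the blocks of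
`x + e_μ, x, x + v + e_μ, x + v` at rate `δ₁` from the neighbour patches `holder_dkernel_decay_blocks` at `s = α + γ∕2`); the rate factor
`R_K,n = √(C₅⁗(K, n)·(L^K)^{−γ}·2c)` is King's, the patch rate is `(L^K)^{−γ∕2}`.
[cite: King1986, Prop. 3.8 (3.71) p.664 (line 4), (3.62) p.663, Thm 3.3 (3.8) p.658, Prop. 3.7 (3.65) p.663, p.674] -/
theorem twoRunHolderDeriv_kernel_blockMean_decay_le (dd L : ℕ) (hd : 1 ≤ dd) (hLodd : Odd L) (hL : 2 ≤ L) {a m2 : ℝ}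
    (ha : 0 < a) (hm : 0 < m2) {α γ : ℝ} (hα : 0 < α) (hγ : 0 < γ) (hαγ : α + γ < 1) :
    ∃ δ c δ₁ c₁ : ℝ, 0 < δ ∧ 0 < c ∧ 0 < δ₁ ∧ 0 < c₁ ∧
      ∀ (P : Params) (_hPd : P.d = dd) (_hPL : P.L = L) (_hK : 1 ≤ P.K) [NeZero P.L]
      (n : ℕ) (_hn : 1 ≤ n) (M : Fin P.d → ℕ) [∀ μ, NeZero (M μ)] (_hMK : ∀ μ, M μ = P.sitesPerDir P.K)
      (bt : Tor M) (xt v : Tor (fine (P.L ^ P.K) M)) (μ : Fin P.d),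
      |(holdist (P.L ^ P.K) M xt (xt + v)) ^ (-α) *
          (((P.L ^ P.K : ℕ) : ℝ) *
            ((minimiser (P.L ^ P.K) M (aK a P.L P.K) (((P.L ^ P.K : ℕ) : ℝ) ^ 2) m2 (Pi.single bt 1)
                  (xt + unitVec (fine (P.L ^ P.K) M) μ)
                - (((Finset.univ.filter fun y : Tor (fine (P.L ^ n * P.L ^ P.K) M) =>
                      ∀ ν, ((xt + unitVec (fine (P.L ^ P.K) M) μ) ν).val = (y ν).val / P.L ^ n).card : ℝ))⁻¹ *
                  ∑ y ∈ (Finset.univ.filter fun y : Tor (fine (P.L ^ n * P.L ^ P.K) M) =>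
                      ∀ ν, ((xt + unitVec (fine (P.L ^ P.K) M) μ) ν).val = (y ν).val / P.L ^ n),
                    minimiser (P.L ^ n * P.L ^ P.K) M (aK a P.L (P.K + n)) (((P.L ^ n * P.L ^ P.K : ℕ) : ℝ) ^ 2) m2
                      (Pi.single bt 1) y)
              - (minimiser (P.L ^ P.K) M (aK a P.L P.K) (((P.L ^ P.K : ℕ) : ℝ) ^ 2) m2 (Pi.single bt 1) xt
                - (((Finset.univ.filter fun x' : Tor (fine (P.L ^ n * P.L ^ P.K) M) =>
                      ∀ ν, (xt ν).val = (x' ν).val / P.L ^ n).card : ℝ))⁻¹ *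
                  ∑ x' ∈ (Finset.univ.filter fun x' : Tor (fine (P.L ^ n * P.L ^ P.K) M) =>
                      ∀ ν, (xt ν).val = (x' ν).val / P.L ^ n),
                    minimiser (P.L ^ n * P.L ^ P.K) M (aK a P.L (P.K + n)) (((P.L ^ n * P.L ^ P.K : ℕ) : ℝ) ^ 2) m2
                      (Pi.single bt 1) x'))
          - ((P.L ^ P.K : ℕ) : ℝ) *
            ((minimiser (P.L ^ P.K) M (aK a P.L P.K) (((P.L ^ P.K : ℕ) : ℝ) ^ 2) m2 (Pi.single bt 1)
                  (xt + v + unitVec (fine (P.L ^ P.K) M) μ)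
                - (((Finset.univ.filter fun y : Tor (fine (P.L ^ n * P.L ^ P.K) M) =>
                      ∀ ν, ((xt + v + unitVec (fine (P.L ^ P.K) M) μ) ν).val = (y ν).val / P.L ^ n).card : ℝ))⁻¹ *
                  ∑ y ∈ (Finset.univ.filter fun y : Tor (fine (P.L ^ n * P.L ^ P.K) M) =>
                      ∀ ν, ((xt + v + unitVec (fine (P.L ^ P.K) M) μ) ν).val = (y ν).val / P.L ^ n),
                    minimiser (P.L ^ n * P.L ^ P.K) M (aK a P.L (P.K + n)) (((P.L ^ n * P.L ^ P.K : ℕ) : ℝ) ^ 2) m2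
                      (Pi.single bt 1) y)
              - (minimiser (P.L ^ P.K) M (aK a P.L P.K) (((P.L ^ P.K : ℕ) : ℝ) ^ 2) m2 (Pi.single bt 1) (xt + v)
                - (((Finset.univ.filter fun y : Tor (fine (P.L ^ n * P.L ^ P.K) M) =>
                      ∀ ν, ((xt + v) ν).val = (y ν).val / P.L ^ n).card : ℝ))⁻¹ *
                  ∑ y ∈ (Finset.univ.filter fun y : Tor (fine (P.L ^ n * P.L ^ P.K) M) =>
                      ∀ ν, ((xt + v) ν).val = (y ν).val / P.L ^ n),
                    minimiser (P.L ^ n * P.L ^ P.K) M (aK a P.L (P.K + n)) (((P.L ^ n * P.L ^ P.K : ℕ) : ℝ) ^ 2) m2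
                      (Pi.single bt 1) y)))|
        ≤ Real.sqrt ((fprop38RateConst a a (lemma43Const a P.L P.K n) ((π ^ 2 / 4) ^ P.d) P.d γ (α + 1)
                (2 * (P.d : ℝ) ^ α) (2 * (P.d : ℝ) ^ α * 2 ^ (1 - γ))
              + fprop38PosConst a ((π ^ 2 / 4) ^ P.d) P.d γ (α + 1) (2 * (P.d : ℝ) ^ α) (6 * (P.d : ℝ) ^ (α + γ)))
              * ((P.L ^ P.K : ℕ) : ℝ) ^ (-γ) * (2 * c))
            * ((Real.exp (-(δ / 2 * tdistT M (blockOf (P.L ^ P.K) M (xt)) bt))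
                  + Real.exp (-(δ / 2 * tdistT M (blockOf (P.L ^ P.K) M (xt + v)) bt)))
                + (Real.exp (-(δ / 2 * tdistT M (blockOf (P.L ^ P.K) M (xt + unitVec (fine (P.L ^ P.K) M) μ)) bt))
                  + Real.exp (-(δ / 2 * tdistT M (blockOf (P.L ^ P.K) M (xt + v + unitVec (fine (P.L ^ P.K) M) μ)) bt))))
          + c₁ * ((P.L ^ P.K : ℕ) : ℝ) ^ (-(γ / 2))
            * ((Real.exp (-(δ₁ * tdistT M (blockOf (P.L ^ P.K) M (xt + unitVec (fine (P.L ^ P.K) M) μ)) bt))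
                  + Real.exp (-(δ₁ * tdistT M (blockOf (P.L ^ P.K) M (xt)) bt)))
                + (Real.exp (-(δ₁ * tdistT M (blockOf (P.L ^ P.K) M (xt + v + unitVec (fine (P.L ^ P.K) M) μ)) bt))
                  + Real.exp (-(δ₁ * tdistT M (blockOf (P.L ^ P.K) M (xt + v)) bt)))) := by
  obtain ⟨δ, c, hδ, hc, HK⟩ := king_prop38_holder_deriv_torus_blocks dd L hd hLodd hL ha hm hα hγ hαγ
  obtain ⟨δ₁, c₁, hδ₁, hc₁, HH⟩ :=
    holder_dkernel_decay_blocks dd L hd hLodd hL ha hm (α := α + γ / 2) (by linarith) (by linarith)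
  refine ⟨δ, c, δ₁, c₁, hδ, hc, hδ₁, hc₁, ?_⟩
  intro P hPd hPL hK _ n hn M _ hMK bt xt v μ
  subst hPd hPL
  -- elementary facts
  have hd0 : 0 < P.d := by omega
  have hL0 : 0 < P.L := by omega
  have hLn : 0 < P.L ^ n := pow_pos hL0 n
  have hN2 : 2 ≤ P.L ^ P.K := by
    calc 2 ≤ P.L := hL
      _ = P.L ^ 1 := (pow_one P.L).symm
      _ ≤ P.L ^ P.K := Nat.pow_le_pow_right hL0 hK
  have hM1 : 1 ≤ M μ := Nat.one_le_iff_ne_zero.mpr (NeZero.ne (M μ))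
  have hNM : 2 ≤ P.L ^ P.K * M μ := hN2.trans (Nat.le_mul_of_pos_right _ hM1)
  have hNpos : (0 : ℝ) < ((P.L ^ P.K : ℕ) : ℝ) := by exact_mod_cast (show 0 < P.L ^ P.K by omega)
  -- names: King's rate factor, the uniform rate, the decay profiles around a block
  set Rk : ℝ := Real.sqrt ((fprop38RateConst a a (lemma43Const a P.L P.K n) ((π ^ 2 / 4) ^ P.d) P.d γ (α + 1)
        (2 * (P.d : ℝ) ^ α) (2 * (P.d : ℝ) ^ α * 2 ^ (1 - γ))
      + fprop38PosConst a ((π ^ 2 / 4) ^ P.d) P.d γ (α + 1) (2 * (P.d : ℝ) ^ α) (6 * (P.d : ℝ) ^ (α + γ)))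
      * ((P.L ^ P.K : ℕ) : ℝ) ^ (-γ) * (2 * c)) with hRk
  set ρr : ℝ := ((P.L ^ P.K : ℕ) : ℝ) ^ (-(γ / 2)) with hρr
  have hRk0 : 0 ≤ Rk := Real.sqrt_nonneg _
  have hρr0 : 0 ≤ ρr := Real.rpow_nonneg (Nat.cast_nonneg _) _
  set E : Tor (fine (P.L ^ P.K) M) → Tor M → ℝ :=
    fun z bt => Real.exp (-(δ / 2 * tdistT M (blockOf (P.L ^ P.K) M z) bt)) with hE
  set E₁ : Tor (fine (P.L ^ P.K) M) → Tor M → ℝ :=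
    fun z bt => Real.exp (-(δ₁ * tdistT M (blockOf (P.L ^ P.K) M z) bt)) with hE₁
  have hE0 : ∀ z bt, 0 ≤ E z bt := fun z bt => (Real.exp_pos _).le
  have hE₁0 : ∀ z bt, 0 ≤ E₁ z bt := fun z bt => (Real.exp_pos _).le
  -- the neighbour patch with decay at `z ∈ {xt, xt + v}`: `|∂ℋ_K(z + e_μ, bt) − ∂ℋ_K(z, bt)| ≤ c₁·N^{−(α+γ∕2)}·(E₁(z + e_μ) + E₁ z)`
  have hnb : ∀ (z : Tor (fine (P.L ^ P.K) M)) (bt : Tor M),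
      |((P.L ^ P.K : ℕ) : ℝ) *
          (minimiser (P.L ^ P.K) M (aK a P.L P.K) (((P.L ^ P.K : ℕ) : ℝ) ^ 2) m2 (Pi.single bt 1)
              (z + unitVec (fine (P.L ^ P.K) M) μ + unitVec (fine (P.L ^ P.K) M) μ)
            - minimiser (P.L ^ P.K) M (aK a P.L P.K) (((P.L ^ P.K : ℕ) : ℝ) ^ 2) m2 (Pi.single bt 1)
              (z + unitVec (fine (P.L ^ P.K) M) μ))
        - ((P.L ^ P.K : ℕ) : ℝ) *
          (minimiser (P.L ^ P.K) M (aK a P.L P.K) (((P.L ^ P.K : ℕ) : ℝ) ^ 2) m2 (Pi.single bt 1)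
              (z + unitVec (fine (P.L ^ P.K) M) μ)
            - minimiser (P.L ^ P.K) M (aK a P.L P.K) (((P.L ^ P.K : ℕ) : ℝ) ^ 2) m2 (Pi.single bt 1) z)|
        ≤ c₁ * (((P.L ^ P.K : ℕ) : ℝ))⁻¹ ^ (α + γ / 2) * (E₁ (z + unitVec (fine (P.L ^ P.K) M) μ) bt + E₁ z bt) := by
    intro z bt
    have h := HH P rfl rfl hK M hMK (P.L ^ P.K) rfl (z + unitVec (fine (P.L ^ P.K) M) μ) z bt μ
    rw [holdist_add_unitVec hNM z] at h
    have h2 := abs_le_of_holder_bound (inv_pos.2 hNpos) h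
    refine h2.trans ?_
    have h3 := exp_neg_mul_min_le δ₁ (tdistT M (blockOf (P.L ^ P.K) M (z + unitVec (fine (P.L ^ P.K) M) μ)) bt)
      (tdistT M (blockOf (P.L ^ P.K) M z) bt)
    calc c₁ * Real.exp (-(δ₁ * min (tdistT M (blockOf (P.L ^ P.K) M (z + unitVec (fine (P.L ^ P.K) M) μ)) bt)
            (tdistT M (blockOf (P.L ^ P.K) M z) bt))) * (((P.L ^ P.K : ℕ) : ℝ))⁻¹ ^ (α + γ / 2)
        = c₁ * (((P.L ^ P.K : ℕ) : ℝ))⁻¹ ^ (α + γ / 2) *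
            Real.exp (-(δ₁ * min (tdistT M (blockOf (P.L ^ P.K) M (z + unitVec (fine (P.L ^ P.K) M) μ)) bt)
              (tdistT M (blockOf (P.L ^ P.K) M z) bt))) := by ring
      _ ≤ _ := mul_le_mul_of_nonneg_left h3 (mul_nonneg hc₁.le (Real.rpow_nonneg (inv_nonneg.2 hNpos.le) _))
  -- the mixed patch with decay: `≤ c₁·ρr·(E₁(xt + e_μ) + E₁ xt + E₁(xt + v + e_μ) + E₁(xt + v))`
  have hpatch : ∀ bt : Tor M,
      |(holdist (P.L ^ P.K) M xt (xt + v)) ^ (-α) *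
          ((((P.L ^ P.K : ℕ) : ℝ) *
              (minimiser (P.L ^ P.K) M (aK a P.L P.K) (((P.L ^ P.K : ℕ) : ℝ) ^ 2) m2 (Pi.single bt 1)
                  (xt + unitVec (fine (P.L ^ P.K) M) μ + unitVec (fine (P.L ^ P.K) M) μ)
                - minimiser (P.L ^ P.K) M (aK a P.L P.K) (((P.L ^ P.K : ℕ) : ℝ) ^ 2) m2 (Pi.single bt 1)
                  (xt + unitVec (fine (P.L ^ P.K) M) μ))
              - ((P.L ^ P.K : ℕ) : ℝ) *
                (minimiser (P.L ^ P.K) M (aK a P.L P.K) (((P.L ^ P.K : ℕ) : ℝ) ^ 2) m2 (Pi.single bt 1)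
                    (xt + v + unitVec (fine (P.L ^ P.K) M) μ + unitVec (fine (P.L ^ P.K) M) μ)
                  - minimiser (P.L ^ P.K) M (aK a P.L P.K) (((P.L ^ P.K : ℕ) : ℝ) ^ 2) m2 (Pi.single bt 1)
                    (xt + v + unitVec (fine (P.L ^ P.K) M) μ)))
            - (((P.L ^ P.K : ℕ) : ℝ) *
                (minimiser (P.L ^ P.K) M (aK a P.L P.K) (((P.L ^ P.K : ℕ) : ℝ) ^ 2) m2 (Pi.single bt 1)
                    (xt + unitVec (fine (P.L ^ P.K) M) μ)
                  - minimiser (P.L ^ P.K) M (aK a P.L P.K) (((P.L ^ P.K : ℕ) : ℝ) ^ 2) m2 (Pi.single bt 1) xt)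
              - ((P.L ^ P.K : ℕ) : ℝ) *
                (minimiser (P.L ^ P.K) M (aK a P.L P.K) (((P.L ^ P.K : ℕ) : ℝ) ^ 2) m2 (Pi.single bt 1)
                    (xt + v + unitVec (fine (P.L ^ P.K) M) μ)
                  - minimiser (P.L ^ P.K) M (aK a P.L P.K) (((P.L ^ P.K : ℕ) : ℝ) ^ 2) m2 (Pi.single bt 1) (xt + v))))|
        ≤ c₁ * ρr * ((E₁ (xt + unitVec (fine (P.L ^ P.K) M) μ) bt + E₁ xt bt)
            + (E₁ (xt + v + unitVec (fine (P.L ^ P.K) M) μ) bt + E₁ (xt + v) bt)) := by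
    intro bt
    have hrhs : 0 ≤ c₁ * ρr * ((E₁ (xt + unitVec (fine (P.L ^ P.K) M) μ) bt + E₁ xt bt)
        + (E₁ (xt + v + unitVec (fine (P.L ^ P.K) M) μ) bt + E₁ (xt + v) bt)) :=
      mul_nonneg (mul_nonneg hc₁.le hρr0)
        (add_nonneg (add_nonneg (hE₁0 _ _) (hE₁0 _ _)) (add_nonneg (hE₁0 _ _) (hE₁0 _ _)))
    by_cases hv : v = 0
    · rw [hv]
      simp only [add_zero, sub_self, mul_zero, abs_zero]
      rw [hv] at hrhs
      simpa only [add_zero] using hrhs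
    have hw := rpow_neg_holdist_le (M := M) (by omega) xt v hv hα.le
    have hw0 : 0 ≤ (holdist (P.L ^ P.K) M xt (xt + v)) ^ (-α) :=
      Real.rpow_nonneg (div_nonneg (tdistT_nonneg _ _ _) (Nat.cast_nonneg _)) _
    rw [abs_mul, abs_of_nonneg hw0]
    have hrew : ∀ P1 P2 Q1 Q2 : ℝ, (P1 - P2) - (Q1 - Q2) = (P1 - Q1) - (P2 - Q2) := by intros; ring
    rw [hrew]
    have hsum := (abs_sub _ _).trans (add_le_add (hnb xt bt) (hnb (xt + v) bt))
    have hNN : ((P.L ^ P.K : ℕ) : ℝ) ^ α * (((P.L ^ P.K : ℕ) : ℝ))⁻¹ ^ (α + γ / 2) = ρr := by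
      rw [hρr, Real.inv_rpow hNpos.le, ← Real.rpow_neg hNpos.le, ← Real.rpow_add hNpos]
      ring_nf
    calc _ ≤ ((P.L ^ P.K : ℕ) : ℝ) ^ α *
          (c₁ * (((P.L ^ P.K : ℕ) : ℝ))⁻¹ ^ (α + γ / 2) * (E₁ (xt + unitVec (fine (P.L ^ P.K) M) μ) bt + E₁ xt bt)
            + c₁ * (((P.L ^ P.K : ℕ) : ℝ))⁻¹ ^ (α + γ / 2) *
              (E₁ (xt + v + unitVec (fine (P.L ^ P.K) M) μ) bt + E₁ (xt + v) bt)) :=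
        mul_le_mul hw hsum (abs_nonneg _) (Real.rpow_nonneg hNpos.le _)
      _ = c₁ * (((P.L ^ P.K : ℕ) : ℝ) ^ α * (((P.L ^ P.K : ℕ) : ℝ))⁻¹ ^ (α + γ / 2)) *
          ((E₁ (xt + unitVec (fine (P.L ^ P.K) M) μ) bt + E₁ xt bt)
            + (E₁ (xt + v + unitVec (fine (P.L ^ P.K) M) μ) bt + E₁ (xt + v) bt)) := by ring
      _ = _ := by rw [hNN]
  -- the per-kernel bound: PART 1's mechanism with the decaying inputs
  -- split, commute, translate (as in PART 1)
  have hrew : ∀ w a1 q1 a0 q0 b1 p1 b0 p0 : ℝ,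
      w * (((P.L ^ P.K : ℕ) : ℝ) * ((a1 - q1) - (a0 - q0)) - ((P.L ^ P.K : ℕ) : ℝ) * ((b1 - p1) - (b0 - p0)))
        = w * (((P.L ^ P.K : ℕ) : ℝ) * (a1 - a0) - ((P.L ^ P.K : ℕ) : ℝ) * (b1 - b0))
          - w * (((P.L ^ P.K : ℕ) : ℝ) * (q1 - q0) - ((P.L ^ P.K : ℕ) : ℝ) * (p1 - p0)) := by intros; ring
  rw [hrew, coarseDeriv_blockMean_eq M xt μ
      (minimiser (P.L ^ n * P.L ^ P.K) M (aK a P.L (P.K + n)) (((P.L ^ n * P.L ^ P.K : ℕ) : ℝ) ^ 2) m2 (Pi.single bt 1)),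
    coarseDeriv_blockMean_eq M (xt + v) μ
      (minimiser (P.L ^ n * P.L ^ P.K) M (aK a P.L (P.K + n)) (((P.L ^ n * P.L ^ P.K : ℕ) : ℝ) ^ 2) m2 (Pi.single bt 1))]
  have hT := blockMean_translate xt v (fun x' : Tor (fine (P.L ^ n * P.L ^ P.K) M) =>
    (((P.L ^ n : ℕ) : ℝ))⁻¹ * ∑ j ∈ Finset.range (P.L ^ n), ((P.L ^ n * P.L ^ P.K : ℕ) : ℝ) *
      (minimiser (P.L ^ n * P.L ^ P.K) M (aK a P.L (P.K + n)) (((P.L ^ n * P.L ^ P.K : ℕ) : ℝ) ^ 2) m2 (Pi.single bt 1)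
          (x' + j • unitVec (fine (P.L ^ n * P.L ^ P.K) M) μ + unitVec (fine (P.L ^ n * P.L ^ P.K) M) μ)
        - minimiser (P.L ^ n * P.L ^ P.K) M (aK a P.L (P.K + n)) (((P.L ^ n * P.L ^ P.K : ℕ) : ℝ) ^ 2) m2 (Pi.single bt 1)
          (x' + j • unitVec (fine (P.L ^ n * P.L ^ P.K) M) μ)))
  beta_reduce at hT
  rw [hT]
  set F : Tor (fine (P.L ^ n * P.L ^ P.K) M) → ℝ :=
    minimiser (P.L ^ n * P.L ^ P.K) M (aK a P.L (P.K + n)) (((P.L ^ n * P.L ^ P.K : ℕ) : ℝ) ^ 2) m2 (Pi.single bt 1) with hF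
  set A : Tor (fine (P.L ^ P.K) M) → ℝ :=
    minimiser (P.L ^ P.K) M (aK a P.L P.K) (((P.L ^ P.K : ℕ) : ℝ) ^ 2) m2 (Pi.single bt 1) with hA
  set ρ : ℝ := holdist (P.L ^ P.K) M xt (xt + v) with hρ
  set t : ℝ := ρ ^ (-α) * (((P.L ^ P.K : ℕ) : ℝ) * (A (xt + unitVec (fine (P.L ^ P.K) M) μ) - A xt)
    - ((P.L ^ P.K : ℕ) : ℝ) * (A (xt + v + unitVec (fine (P.L ^ P.K) M) μ) - A (xt + v))) with ht
  set β : ℝ := Rk * ((E xt bt + E (xt + v) bt)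
            + (E (xt + unitVec (fine (P.L ^ P.K) M) μ) bt + E (xt + v + unitVec (fine (P.L ^ P.K) M) μ) bt))
        + c₁ * ρr * ((E₁ (xt + unitVec (fine (P.L ^ P.K) M) μ) bt + E₁ xt bt)
            + (E₁ (xt + v + unitVec (fine (P.L ^ P.K) M) μ) bt + E₁ (xt + v) bt)) with hβ
  -- pointwise at every fine point read by the derivative of the block mean
  have hpt : ∀ x' : Tor (fine (P.L ^ n * P.L ^ P.K) M), (∀ ν, (xt ν).val = (x' ν).val / P.L ^ n) →
      ∀ j ∈ Finset.range (P.L ^ n),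
      |ρ ^ (-α) * (((P.L ^ n * P.L ^ P.K : ℕ) : ℝ) *
            (F (x' + j • unitVec (fine (P.L ^ n * P.L ^ P.K) M) μ + unitVec (fine (P.L ^ n * P.L ^ P.K) M) μ)
              - F (x' + j • unitVec (fine (P.L ^ n * P.L ^ P.K) M) μ))
          - ((P.L ^ n * P.L ^ P.K : ℕ) : ℝ) *
            (F (x' + (fun ν => (((v ν).val * P.L ^ n : ℕ) : ZMod (fine (P.L ^ n * P.L ^ P.K) M ν)))
                + j • unitVec (fine (P.L ^ n * P.L ^ P.K) M) μ + unitVec (fine (P.L ^ n * P.L ^ P.K) M) μ)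
              - F (x' + (fun ν => (((v ν).val * P.L ^ n : ℕ) : ZMod (fine (P.L ^ n * P.L ^ P.K) M ν)))
                + j • unitVec (fine (P.L ^ n * P.L ^ P.K) M) μ))) - t| ≤ β := by
    intro x' hx' j hj
    have hjlt : j < P.L ^ n := Finset.mem_range.1 hj
    have hcomm : x' + (fun ν => (((v ν).val * P.L ^ n : ℕ) : ZMod (fine (P.L ^ n * P.L ^ P.K) M ν)))
          + j • unitVec (fine (P.L ^ n * P.L ^ P.K) M) μ
        = x' + j • unitVec (fine (P.L ^ n * P.L ^ P.K) M) μ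
          + (fun ν => (((v ν).val * P.L ^ n : ℕ) : ZMod (fine (P.L ^ n * P.L ^ P.K) M ν))) := add_right_comm _ _ _
    rw [hcomm]
    have hpos : 0 ≤ c₁ * ρr * ((E₁ (xt + unitVec (fine (P.L ^ P.K) M) μ) bt + E₁ xt bt)
        + (E₁ (xt + v + unitVec (fine (P.L ^ P.K) M) μ) bt + E₁ (xt + v) bt)) :=
      mul_nonneg (mul_nonneg hc₁.le hρr0)
        (add_nonneg (add_nonneg (hE₁0 _ _) (hE₁0 _ _)) (add_nonneg (hE₁0 _ _) (hE₁0 _ _)))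
    rcases over_add_nsmul_cases xt x' hx' μ hjlt with h0 | h1
    · -- over `xt`: line 4 with decay at the pair `(xt, xt + v)`
      have hover := over_add_translate xt (x' + j • unitVec (fine (P.L ^ n * P.L ^ P.K) M) μ) h0 v
      have h := HK P rfl rfl hK n hn M hMK xt (xt + v) (x' + j • unitVec (fine (P.L ^ n * P.L ^ P.K) M) μ) _ bt h0 hover μ
      rw [holdist_translate xt v (x' + j • unitVec (fine (P.L ^ n * P.L ^ P.K) M) μ)] at h
      have h' := h.trans (mul_le_mul_of_nonneg_left
        (exp_neg_mul_min_le (δ / 2) (tdistT M (blockOf (P.L ^ P.K) M xt) bt) (tdistT M (blockOf (P.L ^ P.K) M (xt + v)) bt))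
        hRk0)
      refine h'.trans ?_
      have h2 : 0 ≤ Rk * (E (xt + unitVec (fine (P.L ^ P.K) M) μ) bt + E (xt + v + unitVec (fine (P.L ^ P.K) M) μ) bt) :=
        mul_nonneg hRk0 (add_nonneg (hE0 _ _) (hE0 _ _))
      rw [hβ]
      show Rk * (E xt bt + E (xt + v) bt) ≤ _
      linarith
    · -- over `xt + e_μ`: line 4 with decay at the pair `(xt + e_μ, xt + e_μ + v)` plus the mixed patch with decay
      have hover := over_add_translate (xt + unitVec (fine (P.L ^ P.K) M) μ) (x' + j • unitVec (fine (P.L ^ n * P.L ^ P.K) M) μ) h1 v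
      have h := HK P rfl rfl hK n hn M hMK (xt + unitVec (fine (P.L ^ P.K) M) μ) (xt + unitVec (fine (P.L ^ P.K) M) μ + v) (x' + j • unitVec (fine (P.L ^ n * P.L ^ P.K) M) μ) _ bt h1 hover μ
      rw [holdist_translate (xt + unitVec (fine (P.L ^ P.K) M) μ) v (x' + j • unitVec (fine (P.L ^ n * P.L ^ P.K) M) μ), holdist_pair_shift xt (unitVec (fine (P.L ^ P.K) M) μ) v,
        add_right_comm xt (unitVec (fine (P.L ^ P.K) M) μ) v] at h
      have h' := h.trans (mul_le_mul_of_nonneg_left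
        (exp_neg_mul_min_le (δ / 2) (tdistT M (blockOf (P.L ^ P.K) M (xt + unitVec (fine (P.L ^ P.K) M) μ)) bt)
          (tdistT M (blockOf (P.L ^ P.K) M (xt + v + unitVec (fine (P.L ^ P.K) M) μ)) bt)) hRk0)
      have hrew2 : ∀ w P1 P2 Q1 Q2 : ℝ, w * (P1 - P2) - w * (Q1 - Q2) = w * ((P1 - P2) - (Q1 - Q2)) := by intros; ring
      have hP' : |ρ ^ (-α) * (((P.L ^ P.K : ℕ) : ℝ) *
            (A (xt + unitVec (fine (P.L ^ P.K) M) μ + unitVec (fine (P.L ^ P.K) M) μ) - A (xt + unitVec (fine (P.L ^ P.K) M) μ))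
            - ((P.L ^ P.K : ℕ) : ℝ) *
              (A (xt + v + unitVec (fine (P.L ^ P.K) M) μ + unitVec (fine (P.L ^ P.K) M) μ)
                - A (xt + v + unitVec (fine (P.L ^ P.K) M) μ))) - t|
          ≤ c₁ * ρr * ((E₁ (xt + unitVec (fine (P.L ^ P.K) M) μ) bt + E₁ xt bt)
            + (E₁ (xt + v + unitVec (fine (P.L ^ P.K) M) μ) bt + E₁ (xt + v) bt)) := by
        rw [ht, hrew2]
        exact hpatch bt
      refine ((abs_sub_le _ _ _).trans (add_le_add h' hP')).trans ?_
      have h2 : 0 ≤ Rk * (E xt bt + E (xt + v) bt) := mul_nonneg hRk0 (add_nonneg (hE0 _ _) (hE0 _ _))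
      rw [hβ]
      show Rk * (E (xt + unitVec (fine (P.L ^ P.K) M) μ) bt + E (xt + v + unitVec (fine (P.L ^ P.K) M) μ) bt)
        + c₁ * ρr * ((E₁ (xt + unitVec (fine (P.L ^ P.K) M) μ) bt + E₁ xt bt)
          + (E₁ (xt + v + unitVec (fine (P.L ^ P.K) M) μ) bt + E₁ (xt + v) bt)) ≤ _
      linarith
  have hmean := abs_blockMean_sub_le (overFib_nonempty (by omega) P.K n M xt)
    (f := fun x' : Tor (fine (P.L ^ n * P.L ^ P.K) M) => ρ ^ (-α) *
      ((((P.L ^ n : ℕ) : ℝ))⁻¹ * ∑ j ∈ Finset.range (P.L ^ n), ((P.L ^ n * P.L ^ P.K : ℕ) : ℝ) *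
          (F (x' + j • unitVec (fine (P.L ^ n * P.L ^ P.K) M) μ + unitVec (fine (P.L ^ n * P.L ^ P.K) M) μ)
            - F (x' + j • unitVec (fine (P.L ^ n * P.L ^ P.K) M) μ))
        - (((P.L ^ n : ℕ) : ℝ))⁻¹ * ∑ j ∈ Finset.range (P.L ^ n), ((P.L ^ n * P.L ^ P.K : ℕ) : ℝ) *
          (F (x' + (fun ν => (((v ν).val * P.L ^ n : ℕ) : ZMod (fine (P.L ^ n * P.L ^ P.K) M ν)))
              + j • unitVec (fine (P.L ^ n * P.L ^ P.K) M) μ + unitVec (fine (P.L ^ n * P.L ^ P.K) M) μ)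
            - F (x' + (fun ν => (((v ν).val * P.L ^ n : ℕ) : ZMod (fine (P.L ^ n * P.L ^ P.K) M ν)))
              + j • unitVec (fine (P.L ^ n * P.L ^ P.K) M) μ))))
    (t := t) (C := β)
    (fun x' hx' => by
      have hx := mem_overFib.1 hx'
      rw [weight_rangeMean_sub]
      exact abs_rangeMean_sub_le hLn (fun j hj => hpt x' hx j hj))
  rw [blockMean_mul_sub, abs_sub_comm] at hmean
  exact hmean

end Summit.QuantumFields.YangMills.BalabanUVNodes.N16KingModelHolderDerivDecay

end
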